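import Mathlib.Tactic
import Literature.Geometry.Lorentzian.KlainermanSzeftel2021.FrameChangeLedger

/-!
# The printed derivative losses of the frame-transition transport systems of [KS], composed in series: Theorem M6's last sentence (finding E31)

CITATION HEADER (lean-in-tree rule 2026-08-18).  Kernel-checked transcription of INTEGER BOOKKEEPING printed in
* [KS] S. Klainerman, J. Szeftel, *Kerr stability for small angular momentum*, Pure Appl. Math. Q. **19** (2023) no. 3, 791–1678
  = bib key `KlainermanSzeftel2023`, read as the authors' accepted version HAL hal-04280491 ("HAL p.N Lm" = PDF page N, line m), and its
  e-print arXiv:2104.11857v1 = bib key `KlainermanSzeftel2021` (TeX `Main-Kerr-arxiv.tex`, "l.N");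
* [KS-Schw] S. Klainerman, J. Szeftel, *Global Nonlinear Stability of Schwarzschild Spacetime under Polarized Perturbations*, Ann. of Math.
  Studies **210**, Princeton UP 2020 = bib key `KlainermanSzeftel2020` (book "p.N" = page file of the held text; e-print arXiv:1711.07597v2 "Schw l.N").
Audit-cell `pub-kerr` (Final-State-Conjecture near-miss cell, phase 1: typed skeleton + census), GAPS.md Block 33 (+ ADDENDUM), finding **E31**
(lead block 31: class E, OPEN-PRICED, not gate-red; Dag K-node `KS8.4-S8`).  Companion of `InitializationLedger` (module 42: the §8.4 display
indices, `frameToRicciCost`, `m6_last_step_under_cost`), `FrameChangeLedger` (module 46: `pgTransportLoss`, the §9.4.3 chain) and `GCMHRungLedger`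
(module 39: the Σ_* supply); their constants are used BY NAME, nothing is redeclared.

WHAT IS TRANSCRIBED (every `def` is a printed integer or a printed integration ORDER, with its locus; nothing analytic).
(A) The three transport systems for frame-transition coefficients `(f, f̲, λ)` and the ORDER in which the texts integrate them:
  * OUTGOING PG target frame — [KS] Cor 2.2.5 (HAL p.67 L38 – p.68 L46 = l.2494–2528): `∇_{λ⁻¹e₄'}F = …(no derivative of f̲, λ)`, `λ⁻¹∇₄'(log λ)
    = 2ω + f·(ζ−η̲) + E₂(f, Γ)` (f undifferentiated), `∇_{λ⁻¹e₄'}F̲ = … + 2𝒟'(log λ) + 2ω̲F + E₃(∇'^{≤1}f, f̲, Γ, λ⁻¹χ')`; Remark 2.2.6 (p.68 L48–52 =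
    l.2535–2537): "we will integrate first the transport equations for F, then for λ. Finally … F̲ and we recover one less derivative than for F
    and log(λ)" — loss vector (0, 1, 0) on (f, f̲, λ), integration order F, λ, F̲.
  * INGOING PG target frame — "By exchanging the role of e₃ and e₄, we have the following analog of the transport equations of Corollary 2.2.5"
    ([KS] proof of Lemma 4.5.1, HAL p.226 L47–58; third equation `… −2(H−Z) − 2𝒟'(log λ') + 2ω̲F̲' + E₃(∇'^{≤1}f̲', f', Γ, λχ̲')`), displayed
    again at §9.4.3 Step 5 (HAL p.620 L2–39 = l.24206–24228, TeX `E_3({\nab'}^{\leq 1}\fb', f', \Ga, {\la'}^{-1}\chib')`, output `(f̲', log λ')` at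
    `k_large+4`, `f'` at `k_large+3`) and in the e-print at l.8889–8901 ("propagating first F̲', then λ', and finally F'": `(f̲', log λ')` at
    `k_small+128`, `f'` at `k_small+127`) and l.8944–8981 — loss vector (1, 0, 0), integration order F̲, λ, F.  `FrameChangeLedger.pgTransportLoss = 1`.
  * PT target frame — Cor 2.8.8 / Remark 2.8.9 (HAL p.113 L62–66 = l.4814–4817: "the transport equation for F̲ in Corollary 2.8.8 is at the same
    regularity level that the one for F and λ, while the one for F̲ in Corollary 2.2.5 loses one derivative. This is another manifestation of the
    fact that, unlike the PT frame, the PG frame exhibits a loss of derivative"); ingoing PT instance (4.4.14) (HAL p.213 L22–32) — loss (0, 0, 0).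
(B) The frame → Ricci passage "the transformation formulas of Proposition 2.2.3 … imply": Prop 2.2.3 prints `λ⁻¹trχ' = trχ + div'f + …`
  (HAL p.63 L41 = l.2305), `λ⁻¹χ̂' = χ̂ + ∇'⊗̂f + …` (p.64 L2 = l.2319), `λ⁻²ξ' = ξ + ½λ⁻¹∇'₄f + …` (p.63 L11 = l.2288), `λtrχ̲' = trχ̲ + div'f̲ + …`
  (p.64 L17 = l.2329); for ingoing PG structures `Γ_g ∋ Ξ, ω̌, trX̌, X̂, Ž, Ȟ̲, …` ([KS] Def 2.7.3 (2.7.11), HAL p.105 L26–40 = l.4447–4458) and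
  `(int)𝔅_k := sup_{(int)ℳ}{|𝔡^{≤k}Γ_g| + |𝔡^{≤k}Γ_b|}` (p.136 L12 = l.5882–5886): the new Ricci coefficients sit ONE below the least regular
  coefficient — `InitializationLedger.frameToRicciCost = 1`.
(C) The printed charge of passage (B) at every locus where the four texts print it with indices (§3, 19 rows): the coefficient minimum and the
  derived Ricci index, as offsets from the locus's own base symbol (`k_small`, `k_large` or `k_*`).

WHAT IS CERTIFIED (ℕ/ℤ arithmetic only; `omega` / `decide`).  §2: composing the OUTGOING system on `(ext)ℳ` (data on Σ_* at the printed
(8.4.27) level `k_large+2`, `InitializationLedger.sigmaStarLevel`) with the INGOING system on `(int)ℳ`/`(top)ℳ` (data on 𝒯 / {u = u_*} = the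
`(ext)ℳ` output, l.21570) reproduces the printed displays (8.4.28) `(f, log λ)` at `k_large+2`, `f̲` at `k_large+1` and (8.4.31) `(f̲, log λ)` at
`k_large+1`, `f` at `k_large` EXACTLY (`mext_eq_printed`, `mint_eq_printed`) — so (8.4.31) is the honest output of the printed mechanism, two PG
losses in series — and passage (B) then lands the `f`-members `{Ξ', trX̌', X̂'}` of `(int)𝔅`/`(top)𝔅` at `k_large − 1`, ONE BELOW the index
`k_large` of the concluding line "𝔑^{(Sup)}_{k_large} + 𝔑^{(Dec)}_{k_small} ≲ ε₀ … which concludes the proof of Theorem M6" (HAL p.550 L47–53 =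
l.21583–21587) (`e31_int_one_short`), while the `(ext)ℳ` branch lands exactly on `k_large` (`ext_branch_exact`); the SAME calculus reproduces
§9.4.3 Steps 5–6 of Theorem M8 and [KS-Schw] §8.1 (Theorem M6 there) INCLUDING their printed final indices (`m8_twin_exact`,
`schw_twin_with_room`) — the E31 locus is the one place where the printed final index exceeds the calculus.  §3: of the 19 printed instances of
passage (B), the `(int)`/`(top)` branch of [KS] §8.4 Step 8 is the UNIQUE one charged 0 from the least regular coefficient; all others are
charged ≥ 1 (`charge_eq_zero_iff`, `one_le_charge_of_ne`).  §4: the whole printed chain from the data norm `𝓘_{k_large+10}` of the Main Theorem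
(version 2, HAL p.143 L2–5 = l.6207–6213) to `{Ξ', trX̌', X̂'}|_{(int)ℳ}` spends 3 − 1 + 2 + 4 + 0 + 1 + 1 + 1 = 11 derivatives against the
10 available (`total_loss_eq_eleven`, `data_index_short_by_one`), and `k_large + 11` closes it (`data_plus_one_closes`) — GAPS Block 33 (6):
price (c), STATEMENT-ADJACENT (it moves the printed hypothesis index of the Main Theorem by one); price (a) of lead block 31 (a loss-free ingoing
transport of f) does not exist in print (§1: the ingoing system's lossy unknown IS f); price (b′) = an unprinted sharpening of
`GCMHRungLedger.prop827Loss` (3) or of the Σ_* descent `supLevel − sigmaStarLevel` (4).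

STATUS / RELATION.  NOTHING analytic is asserted: no estimate of [KS]/[KS-Schw] is formalised, only the indices and integration orders they
print; whether Theorem M6's `(int)𝔅_{k_large}` closes by an argument not displayed in §8.4 (reading R2 of GAPS block 30) is NOT decided by a
kernel — Block 33 records that no such argument is PRINTED.  Thm M6's STATEMENT ([1, 1+δ₀] ⊂ 𝒰(u_*), `Bootstrap.ThmM6`) is not touched.
Mathlib + the three sibling ledgers only.  Not Final-State-Conjecture progress.
-/

namespace Literature.Geometry.Lorentzian.KlainermanSzeftel2021.TransitionLossLedger

open InitializationLedger (sigmaStarLevel extLevel extFbLevel6 intLevel intFLevel6 targetM6 frameToRicciCost supLevel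
  m8IntDisplayLevel m8SupNormLevel)
open FrameChangeLedger (pgTransportLoss step3SupLevel step5BoundaryLevel step5FbLaLevel step5FLevel step6IntFLevel)
open GCMHRungLedger (dataIndex prop827Loss smaxKS K sobolevCost ksTopIndex)

/-! ## §1 Regularity triples and the three printed transport systems -/

/-- Derivative orders (sup-norm, `𝔡^{≤·}`) at which the transition coefficients `(f, f̲, log λ)` of a frame change are controlled on a region.
[cite: KlainermanSzeftel2023, general frame transformation (2.2.1) and the triple (f, f̲, λ), HAL p.62–63; KlainermanSzeftel2021, l.2281–2283] -/
structure Triple where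
  /-- order of `f` (the 1-form attached to `e₄' = λ(e₄ + f·e + …)`) -/
  f : ℕ
  /-- order of `f̲` (the 1-form attached to `e₃'`) -/
  fb : ℕ
  /-- order of `log λ` -/
  la : ℕ
  deriving DecidableEq, Repr

/-- The least regular coefficient of a triple. [folklore] -/
def Triple.low (t : Triple) : ℕ := min t.f (min t.fb t.la)

/-- OUTGOING PG target frame (Cor 2.2.5, integrated in the order of Remark 2.2.6: F first — its equation carries no derivative of (f̲, λ) and is
capped only by its datum and the background `Γ` at order `bg` —, then λ — `λ⁻¹∇₄'(log λ) = 2ω + f·(ζ−η̲) + E₂(f, Γ)`, f undifferentiated —, then F̲,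
whose (renormalised) equation carries `𝒟'(log λ)`, `𝒟'(f·ζ)` and `E₅(∇'^{≤1}f, f̲, ∇'^{≤1}λ, D^{≤1}Γ)`: ONE derivative of f and λ): output orders.
[cite: KlainermanSzeftel2023, Cor 2.2.5 HAL p.67 L38 – p.68 L46, Rem 2.2.6 p.68 L48–52; KlainermanSzeftel2021, l.2494–2537, l.21524–21533] -/
def outgoingPG (bg : ℕ) (d : Triple) : Triple :=
  { f := min d.f bg
    la := min d.la (min d.f bg)
    fb := min d.fb (min (min d.f bg) (min d.la (min d.f bg)) - pgTransportLoss) }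

/-- INGOING PG target frame ("By exchanging the role of e₃ and e₄ … the following analog of the transport equations of Corollary 2.2.5";
integrated "first F̲', then λ', and finally F'": F̲ capped by datum/background, λ by F̲ (`(λ')⁻¹∇₃'(log λ') = 2ω̲ − f̲'·(ζ+η) + …`), F one below
both (`−2𝒟'(log λ') + … + E₃(∇'^{≤1}f̲', f', Γ, λχ̲')`)): output orders.
[cite: KlainermanSzeftel2023, HAL p.226 L47–58, p.227 L59–106, p.620 L2–39; KlainermanSzeftel2021, l.8889–8901, l.8944–8981, l.24206–24228] -/
def ingoingPG (bg : ℕ) (d : Triple) : Triple :=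
  { fb := min d.fb bg
    la := min d.la (min d.fb bg)
    f := min d.f (min (min d.fb bg) (min d.la (min d.fb bg)) - pgTransportLoss) }

/-- PT target frame (Cor 2.8.8 / its ingoing analog (4.4.14)): "at the same regularity level" — no derivative of the other coefficients in the
third equation: output orders. [cite: KlainermanSzeftel2023, Rem 2.8.9 HAL p.113 L62–66, (4.4.14) p.213 L22–32, (4.4.21) p.218 L28–65;
KlainermanSzeftel2021, l.4814–4817] -/
def targetPT (bg : ℕ) (d : Triple) : Triple :=
  { f := min d.f bg, fb := min d.fb bg, la := min d.la bg }

/-- Passage (B): the new frame's Ricci coefficients contain FIRST derivatives of each coefficient (`trχ' ∋ div'f`, `χ̂' ∋ ∇'⊗̂f`, `ξ' ∋ ∇'₄f`,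
`trχ̲' ∋ div'f̲`, `ζ', ω', ω̲' ∋ ∂log λ`), so `𝔡^{≤k}Γ'` needs the least regular coefficient at `k + 1`: derived Ricci order = `low − frameToRicciCost`.
[cite: KlainermanSzeftel2023, Prop 2.2.3 HAL p.63 L11–41, p.64 L2–17, Def 2.7.3 p.105 L26–40, (int)𝔅_k p.136 L12; KlainermanSzeftel2021,
l.2288, l.2305, l.2312, l.2319, l.2329, l.4447–4458, l.5882–5886] -/
def ricciLevel (t : Triple) : ℕ := t.low - frameToRicciCost

/-- Unfolding lemma. [folklore] -/
@[simp] lemma low_mk (a b c : ℕ) : (Triple.mk a b c).low = min a (min b c) := rfl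
/-- Unfolding lemma. [folklore] -/
@[simp] lemma outgoingPG_def (bg : ℕ) (d : Triple) : outgoingPG bg d =
    { f := min d.f bg, la := min d.la (min d.f bg),
      fb := min d.fb (min (min d.f bg) (min d.la (min d.f bg)) - pgTransportLoss) } := rfl
/-- Unfolding lemma. [folklore] -/
@[simp] lemma ingoingPG_def (bg : ℕ) (d : Triple) : ingoingPG bg d =
    { fb := min d.fb bg, la := min d.la (min d.fb bg),
      f := min d.f (min (min d.fb bg) (min d.la (min d.fb bg)) - pgTransportLoss) } := rfl
/-- Unfolding lemma. [folklore] -/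
@[simp] lemma targetPT_def (bg : ℕ) (d : Triple) :
    targetPT bg d = { f := min d.f bg, fb := min d.fb bg, la := min d.la bg } := rfl
/-- Unfolding lemma. [folklore] -/
@[simp] lemma ricciLevel_def (t : Triple) : ricciLevel t = t.low - frameToRicciCost := rfl

/-- **The printed loss vectors**: with equal data `(s, s, s)` and a background at least as regular, the outgoing PG system returns `(s, s−1, s)`,
the ingoing PG system `(s−1, s, s)`, the PT system `(s, s, s)` — Remark 2.2.6 / the ingoing analog / Remark 2.8.9 as integers.
[cite: KlainermanSzeftel2023, HAL p.68 L48–52, p.113 L62–66, p.227 L97–106; KlainermanSzeftel2021, l.8895–8901] -/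
theorem loss_vectors (s bg : ℕ) (h : s ≤ bg) :
    outgoingPG bg ⟨s, s, s⟩ = ⟨s, s - 1, s⟩ ∧ ingoingPG bg ⟨s, s, s⟩ = ⟨s - 1, s, s⟩ ∧ targetPT bg ⟨s, s, s⟩ = ⟨s, s, s⟩ := by
  simp only [outgoingPG_def, ingoingPG_def, targetPT_def, pgTransportLoss, Triple.mk.injEq]
  omega

/-! ## §2 The §8.4 Step 8 chain as two PG systems in series, and its two printed twins -/

/-- (8.4.27): `(f, f̲, λ − 1)` on Σ_* at `k ≤ k_large + 2`, all three (`InitializationLedger.sigmaStarLevel`).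
[cite: KlainermanSzeftel2023, (8.4.27), HAL p.548 L52–78; KlainermanSzeftel2021, l.21509–21513] -/
def sigmaData (kl : ℕ) : Triple := ⟨sigmaStarLevel kl, sigmaStarLevel kl, sigmaStarLevel kl⟩

/-- `(ext)ℳ`: the outgoing PG frame initialised on Σ_* against the outgoing PG frame of `(ext)ℒ₀`, background at order `bg`
("together with the control of the part `(ext)ℒ₀` of the initial data layer"). [cite: KlainermanSzeftel2023, HAL p.549 L1–33; KlainermanSzeftel2021, l.21520–21533] -/
def mext (kl bg : ℕ) : Triple := outgoingPG bg (sigmaData kl)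

/-- `(int)ℳ` / `(top)ℳ`: the ingoing PG frames initialised on 𝒯 = {r' = r₀} / {u' = u_*} "using the control of (f, f̲, λ) … induced on {r' = r₀}
and {u' = u_*} by (8.4.28)–(8.4.30), and using the analog in the e₃' direction for ingoing PG structures of the above transport equation":
data = the `(ext)ℳ` output. [cite: KlainermanSzeftel2023, HAL p.550 L28–44; KlainermanSzeftel2021, l.21564–21577] -/
def mint (kl bg : ℕ) : Triple := ingoingPG bg (mext kl bg)

/-- Unfolding lemma. [folklore] -/
@[simp] lemma sigmaData_def (kl : ℕ) : sigmaData kl = ⟨sigmaStarLevel kl, sigmaStarLevel kl, sigmaStarLevel kl⟩ := rfl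
/-- Unfolding lemma. [folklore] -/
@[simp] lemma mext_def (kl bg : ℕ) : mext kl bg = outgoingPG bg (sigmaData kl) := rfl
/-- Unfolding lemma. [folklore] -/
@[simp] lemma mint_def (kl bg : ℕ) : mint kl bg = ingoingPG bg (mext kl bg) := rfl

/-- **(8.4.28) is the honest output of Cor 2.2.5 from (8.4.27)**: `(f, log λ)` at `k_large + 2` (`extLevel`), `f̲` at `k_large + 1` (`extFbLevel6`),
for any background at least as regular as the Σ_* data. [cite: KlainermanSzeftel2023, (8.4.28), HAL p.549 L24–33; KlainermanSzeftel2021, l.21530–21533] -/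
theorem mext_eq_printed (kl bg : ℕ) (hbg : kl + 2 ≤ bg) :
    mext kl bg = ⟨extLevel kl, extFbLevel6 kl, extLevel kl⟩ := by
  simp only [mext_def, sigmaData_def, outgoingPG_def, InitializationLedger.sigmaStarLevel_def, InitializationLedger.extLevel_def,
    InitializationLedger.extFbLevel6_def, pgTransportLoss, Triple.mk.injEq]
  omega

/-- **(8.4.31) is the honest output of the ingoing analog from (8.4.28)**: `(f̲, log λ)` at `k_large + 1` (`intLevel`: λ is capped by f̲, which
enters its equation undifferentiated, although its own datum sits at `k_large + 2`), `f` at `k_large` (`intFLevel6`: one below both) — two PG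
losses in series put `f|_{(int)ℳ}` TWO below the Σ_* level. [cite: KlainermanSzeftel2023, (8.4.31), HAL p.550 L32–44; KlainermanSzeftel2021, l.21571–21577] -/
theorem mint_eq_printed (kl bg : ℕ) (hbg : kl + 2 ≤ bg) :
    mint kl bg = ⟨intFLevel6 kl, intLevel kl, intLevel kl⟩ ∧ sigmaStarLevel kl - (mint kl bg).f = 2 := by
  simp only [mint_def, mext_def, sigmaData_def, outgoingPG_def, ingoingPG_def, InitializationLedger.sigmaStarLevel_def,
    InitializationLedger.intLevel_def, InitializationLedger.intFLevel6_def, pgTransportLoss, Triple.mk.injEq]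
  omega

/-- **The `(ext)ℳ` branch of the concluding sentence closes EXACTLY**: the least regular coefficient there is `f̲` at `k_large + 1`, and passage (B)
lands `(ext)𝔅` at `k_large = targetM6` (slack 0). [cite: KlainermanSzeftel2023, HAL p.549 L24–33, p.550 L47–53] -/
theorem ext_branch_exact (kl bg : ℕ) (hbg : kl + 2 ≤ bg) : ricciLevel (mext kl bg) = targetM6 kl := by
  rw [mext_eq_printed kl bg hbg]
  simp only [ricciLevel_def, low_mk, InitializationLedger.extLevel_def, InitializationLedger.extFbLevel6_def,
    InitializationLedger.frameToRicciCost_def, InitializationLedger.targetM6_def]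
  omega

/-- **E31 (GAPS block 30 (4) / lead block 31 / Block 33): the `(int)ℳ`/`(top)ℳ` branch is ONE SHORT.**  The least regular coefficient on `(int)ℳ`
is `f` at `k_large`; the `f`-members `Ξ' ∋ ∇'₄f`, `trX̌' ∋ div'f`, `X̂' ∋ ∇'⊗̂f` of `(int)𝔅_k` therefore come at `k_large − 1`, while the concluding
line asserts `𝔑^{(Sup)}_{k_large} ∋ (int)𝔅_{k_large} + (top)𝔅_{k_large}`.  Integer bookkeeping on printed indices; no estimate is asserted or denied.
[cite: KlainermanSzeftel2023, HAL p.550 L32–53, Prop 2.2.3 p.63 L11–41 / p.64 L2, Def 2.7.3 p.105 L26–40; KlainermanSzeftel2021, l.21571–21587] -/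
theorem e31_int_one_short (kl bg : ℕ) (hkl : 1 ≤ kl) (hbg : kl + 2 ≤ bg) :
    ricciLevel (mint kl bg) + 1 = targetM6 kl ∧ ricciLevel (mint kl bg) < targetM6 kl ∧ (mint kl bg).low = (mint kl bg).f := by
  rw [(mint_eq_printed kl bg hbg).1]
  simp only [ricciLevel_def, low_mk, InitializationLedger.intLevel_def, InitializationLedger.intFLevel6_def,
    InitializationLedger.frameToRicciCost_def, InitializationLedger.targetM6_def]
  omega

/-- **One more derivative on Σ_* closes it** (price (b′)/(c) of Block 33: Σ_* at `k_large + 3` instead of `k_large + 2`): then `f|_{(int)ℳ}` sits at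
`k_large + 1` and passage (B) lands exactly on `k_large`. [folklore] -/
theorem sigma_plus_one_closes (kl bg : ℕ) (hbg : kl + 3 ≤ bg) :
    ricciLevel (ingoingPG bg (outgoingPG bg ⟨kl + 3, kl + 3, kl + 3⟩)) = targetM6 kl ∧
    (ingoingPG bg (outgoingPG bg ⟨kl + 3, kl + 3, kl + 3⟩)).f = kl + 1 := by
  simp only [outgoingPG_def, ingoingPG_def, ricciLevel_def, low_mk, pgTransportLoss, InitializationLedger.frameToRicciCost_def,
    InitializationLedger.targetM6_def]
  omega

/-- **Twin 1 — Theorem M8, §9.4.3 Steps 5–6, reproduced EXACTLY by the same calculus, final index included.**  Data on {u = u_*} at `k_large + 4`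
for all three (`step5BoundaryLevel`), background = the PT frames at `k_large + 4` (Step 3, `step3SupLevel`); the ingoing PG system returns
`(f̲', log λ')` at `k_large + 4` (`step5FbLaLevel`) and `f'` at `k_large + 3` (`step5FLevel` = `step6IntFLevel`), and passage (B) the printed
"for `k ≤ k_large + 2`" (`m8SupNormLevel`) — charge ONE from the lossy coefficient, as printed there.
[cite: KlainermanSzeftel2023, HAL p.619 L29 – p.621 L8; KlainermanSzeftel2021, l.24188–24264] -/
theorem m8_twin_exact (kl : ℕ) :
    ingoingPG (step3SupLevel kl) ⟨step5BoundaryLevel kl, step5BoundaryLevel kl, step5BoundaryLevel kl⟩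
      = ⟨step5FLevel kl, step5FbLaLevel kl, step5FbLaLevel kl⟩ ∧
    step5FLevel kl = step6IntFLevel kl ∧
    ricciLevel ⟨step5FLevel kl, step5FbLaLevel kl, step5FbLaLevel kl⟩ = m8SupNormLevel kl := by
  refine ⟨?_, ?_, ?_⟩
  · simp only [ingoingPG_def, pgTransportLoss, FrameChangeLedger.step3SupLevel_def, FrameChangeLedger.step5BoundaryLevel_def,
      FrameChangeLedger.step5FLevel_def, FrameChangeLedger.step5FbLaLevel_def, Triple.mk.injEq]
    omega
  · simp only [FrameChangeLedger.step5FLevel_def, FrameChangeLedger.step6IntFLevel_def]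
  · simp only [ricciLevel_def, low_mk, FrameChangeLedger.step5FLevel_def, FrameChangeLedger.step5FbLaLevel_def,
      InitializationLedger.frameToRicciCost_def, InitializationLedger.m8SupNormLevel_def]
    omega

/-- [KS-Schw] §8.1 (proof of its Theorem M6): Σ_* sup level `k_large + 4` ((8.1.2), from `L²(S)` at `k_large + 6` by Sobolev, fn 1).
[cite: KlainermanSzeftel2020, (8.1.2) p.435 and fn 1; e-print arXiv:1711.07597v2 l.17342–17351] -/
def schwSigmaLevel (kl : ℕ) : ℕ := kl + 4

/-- [KS-Schw] §8.1: the concluding "max_{k ≤ k_large}" for the Ricci and curvature coefficients of `(ext)ℳ` and `(int)ℳ`.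
[cite: KlainermanSzeftel2020, p.436, the two displays after (8.1.5); e-print l.17392–17404] -/
def schwTarget (kl : ℕ) : ℕ := kl

/-- Unfolding lemma. [folklore] -/
@[simp] lemma schwSigmaLevel_def (kl : ℕ) : schwSigmaLevel kl = kl + 4 := rfl
/-- Unfolding lemma. [folklore] -/
@[simp] lemma schwTarget_def (kl : ℕ) : schwTarget kl = kl := rfl

/-- **Twin 2 — [KS-Schw] Theorem M6, reproduced by the same calculus WITH ROOM.**  From Σ_* at `k_large + 4`: (8.1.4) `(f, log λ)` at `k_large + 4`,
`f̲` at `k_large + 3`; (8.1.5) "using the analog of Corollary 2.93 in the e₃ direction for ingoing foliations, we obtain similarly" `(f̲, log λ)` at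
`k_large + 3`, `f` at `k_large + 2`; passage (B) would allow `k_large + 1` on `(int)ℳ`, the text takes `max_{k ≤ k_large}`: charge 2 where 1 is
forced — one derivative of visible room.  The Kerr text keeps the SAME final index `k_large` with a Σ_* level two LOWER (`sigmaStarLevel = k_large + 2`,
after the Steps 4–8 descent from (8.4.4)), whence E31. [cite: KlainermanSzeftel2020, p.436 (8.1.4)–(8.1.5); KlainermanSzeftel2023, HAL p.548–550] -/
theorem schw_twin_with_room (kl bg : ℕ) (hbg : kl + 4 ≤ bg) :
    outgoingPG bg ⟨schwSigmaLevel kl, schwSigmaLevel kl, schwSigmaLevel kl⟩ = ⟨kl + 4, kl + 3, kl + 4⟩ ∧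
    ingoingPG bg (outgoingPG bg ⟨schwSigmaLevel kl, schwSigmaLevel kl, schwSigmaLevel kl⟩) = ⟨kl + 2, kl + 3, kl + 3⟩ ∧
    ricciLevel (ingoingPG bg (outgoingPG bg ⟨schwSigmaLevel kl, schwSigmaLevel kl, schwSigmaLevel kl⟩)) = schwTarget kl + 1 ∧
    schwSigmaLevel kl - sigmaStarLevel kl = 2 ∧ schwTarget kl = targetM6 kl := by
  refine ⟨?_, ?_, ?_, ?_, ?_⟩
  · simp only [outgoingPG_def, pgTransportLoss, schwSigmaLevel_def, Triple.mk.injEq]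
    omega
  · simp only [outgoingPG_def, ingoingPG_def, pgTransportLoss, schwSigmaLevel_def, Triple.mk.injEq]
    omega
  · simp only [outgoingPG_def, ingoingPG_def, ricciLevel_def, low_mk, pgTransportLoss, schwSigmaLevel_def, schwTarget_def,
      InitializationLedger.frameToRicciCost_def]
    omega
  · simp only [schwSigmaLevel_def, InitializationLedger.sigmaStarLevel_def]
    omega
  · simp only [schwTarget_def, InitializationLedger.targetM6_def]

/-! ## §3 The printed charge of the Prop-2.2.3 passage at every locus with indices (GAPS Block 33 (4)) -/

/-- The loci at which [KS] (both texts) and [KS-Schw] print "the change of frame / transformation formulas of Proposition 2.2.3 [2.90] … imply"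
WITH a derivative index on both sides.  Rows 1–5 = refereed [KS] ch. 4 (base symbol `k_small`); 6–13 = e-print ch. 4 (`k_small`); 14 = Thm M7
§8.5 Step 18 (`k_*`); 15 = Thm M8 §9.4 Step 6 (`k_large`); 16–17 = [KS-Schw] Thm M6 / Thm M0 Step 14 (`k_large`); 18–19 = [KS] Thm M6 §8.4 Step 8,
`(ext)ℳ` branch and `(int)ℳ`/`(top)ℳ` branch (`k_large`). [cite: KlainermanSzeftel2023, HAL p.218–228, p.550, p.592, p.620–621;
KlainermanSzeftel2021, l.8384–8618, l.8652–8998, l.21530–21586, l.23034–23047, l.24234–24264; KlainermanSzeftel2020, p.234, p.436] -/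
inductive Locus
  /-- [J] Prop 4.4.3 Step 5: (4.4.21) `(f, f̲, λ)` k_small+130 (PT, no lossy one) ↦ `(Γ'_b, Γ'_g)` "for k ≤ k_small+129" (HAL p.218 L28 – p.219 L2). -/
  | jProp443
  /-- [J] Lemma 4.5.1, proof: lossy `f'` k_small+129 (pair at 130) ↦ `(Γ'_b, Γ'_g)` k_small+128 (HAL p.227 L97–128, p.228 L40–55). -/
  | jLem451proof
  /-- [J] Lemma 4.5.1, statement: `(f, f̲, log …λ)` k_small+129 ↦ `((int)Γ_g, (int)Γ_b)` k_small+128 (HAL p.221 L7–26). -/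
  | jLem451stmt
  /-- [J] Lemma 4.5.3 (c)/(d): 129 ↦ 128 (HAL p.223 L2–25). -/
  | jLem453
  /-- [J] Lemma 4.5.5 (c)/(d): 129 ↦ 128 (HAL p.224 L19–75). -/
  | jLem455
  /-- e-print Lemma 4.3.1, statement: 128 ↦ 127 (l.8396, l.8402). -/
  | v1Lem431stmt
  /-- e-print Lemma 4.3.1, proof: f, λ 129, lossy f̲ 128 ↦ `(Γ̌', Ř')` 127 (l.8674, l.8707, l.8736, l.8752–8754). -/
  | v1Lem431proof
  /-- e-print Lemma 4.3.4: 128 ↦ 127 (l.8456, l.8450). -/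
  | v1Lem434
  /-- e-print Lemma 4.3.6, `(int)` clause: 127 ↦ 126 (l.8506, l.8497). -/
  | v1Lem436int
  /-- e-print Lemma 4.3.6, `(ext)` clause: 128 ↦ 127 (l.8512, l.8501). -/
  | v1Lem436ext
  /-- e-print §4.3.3, `(top)` from `(int)ℳ`: lossy `f'` 127 (pair 128) ↦ `(Γ_g'', Γ_b'')` 126 (l.8897–8901, l.8929–8931). -/
  | v1Sec433top
  /-- e-print §4.3.3, `(top)` into `(ext)ℳ`: lossy `f''` 128 (f̲'', λ'' 129) ↦ 127 (l.8959, l.8970, l.8980, l.8996–8998). -/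
  | v1Sec433ext
  /-- e-print global-frame Lemma: 127 ↦ 126 (l.8591–8592, l.8582/8586). -/
  | v1Global
  /-- Thm M7 §8.5 Step 18: lossy `f` at k_*−11 ↦ `𝔑^{(Dec)}_{k_*−12}` (l.23034–23047 = HAL p.592). -/
  | ksM7Step18
  /-- Thm M8 §9.4 Step 6: lossy `f''` at k_large+3 ↦ "for k ≤ k_large+2" (l.24234–24264 = HAL p.620–621). -/
  | ksM8Step6
  /-- [KS-Schw] Thm M6: lossy `f` at k_large+2 ↦ max_{k≤k_large} (book p.436 (8.1.5); e-print l.17390–17404). -/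
  | schwM6
  /-- [KS-Schw] Thm M0 Step 14: lossy `f` at k_large+1 ↦ curvature max_{0≤k≤k_large} (book p.234). -/
  | schwM0Step14
  /-- [KS] Thm M6 §8.4 Step 8, `(ext)ℳ` branch: lossy `f̲` at k_large+1 ((8.4.28)) ↦ `𝔑^{(Sup)}_{k_large}` (l.21532, l.21584). -/
  | ksM6Step8Ext
  /-- [KS] Thm M6 §8.4 Step 8, `(int)ℳ`/`(top)ℳ` branch: lossy `f` at k_large ((8.4.31)) ↦ `𝔑^{(Sup)}_{k_large}` (l.21571–21586 = HAL p.550 L32–53). -/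
  | ksM6Step8Int
  deriving DecidableEq, Repr

/-- Printed order of the least regular coefficient at the locus, as an offset from the locus's base symbol. [cite: KlainermanSzeftel2023,
loci in the constructors' docstrings; KlainermanSzeftel2021, idem; KlainermanSzeftel2020, p.234, p.436] -/
def minCoeff : Locus → ℤ
  | .jProp443 => 130 | .jLem451proof => 129 | .jLem451stmt => 129 | .jLem453 => 129 | .jLem455 => 129
  | .v1Lem431stmt => 128 | .v1Lem431proof => 128 | .v1Lem434 => 128 | .v1Lem436int => 127 | .v1Lem436ext => 128
  | .v1Sec433top => 127 | .v1Sec433ext => 128 | .v1Global => 127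
  | .ksM7Step18 => -11 | .ksM8Step6 => 3 | .schwM6 => 2 | .schwM0Step14 => 1 | .ksM6Step8Ext => 1 | .ksM6Step8Int => 0

/-- Printed order of the derived Ricci (and curvature) coefficients at the locus, same offsets. [cite: KlainermanSzeftel2023, loci in the
constructors' docstrings; KlainermanSzeftel2021, idem; KlainermanSzeftel2020, p.234, p.436] -/
def ricciIdx : Locus → ℤ
  | .jProp443 => 129 | .jLem451proof => 128 | .jLem451stmt => 128 | .jLem453 => 128 | .jLem455 => 128
  | .v1Lem431stmt => 127 | .v1Lem431proof => 127 | .v1Lem434 => 127 | .v1Lem436int => 126 | .v1Lem436ext => 127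
  | .v1Sec433top => 126 | .v1Sec433ext => 127 | .v1Global => 126
  | .ksM7Step18 => -12 | .ksM8Step6 => 2 | .schwM6 => 0 | .schwM0Step14 => 0 | .ksM6Step8Ext => 0 | .ksM6Step8Int => 0

/-- The printed charge of passage (B) at a locus: least-regular-coefficient order minus derived Ricci order. [folklore] -/
def charge (l : Locus) : ℤ := minCoeff l - ricciIdx l

/-- All nineteen loci, listed. [folklore] -/
def allLoci : List Locus :=
  [.jProp443, .jLem451proof, .jLem451stmt, .jLem453, .jLem455, .v1Lem431stmt, .v1Lem431proof, .v1Lem434, .v1Lem436int, .v1Lem436ext,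
   .v1Sec433top, .v1Sec433ext, .v1Global, .ksM7Step18, .ksM8Step6, .schwM6, .schwM0Step14, .ksM6Step8Ext, .ksM6Step8Int]

/-- The list is exhaustive. [folklore] -/
theorem mem_allLoci (l : Locus) : l ∈ allLoci := by cases l <;> simp [allLoci]

/-- **The charge table**: 1 at every [KS] ch. 4 locus (both texts), at Thm M7 Step 18, at Thm M8 Step 6, at [KS-Schw] Thm M0 Step 14 and at the
`(ext)ℳ` branch of Thm M6 Step 8; 2 at [KS-Schw] Thm M6; **0 at the `(int)ℳ`/`(top)ℳ` branch of [KS] Thm M6 Step 8**.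
[cite: KlainermanSzeftel2023, HAL p.218–228, p.550, p.592, p.620–621; KlainermanSzeftel2021, l.8396–8998, l.21571–21586; KlainermanSzeftel2020, p.234, p.436] -/
theorem charge_table :
    allLoci.map charge = [1, 1, 1, 1, 1, 1, 1, 1, 1, 1, 1, 1, 1, 1, 1, 2, 1, 1, 0] := by decide

/-- **The `(int)`/`(top)` branch of [KS] §8.4 Step 8 is the UNIQUE printed instance charged zero.** [cite: KlainermanSzeftel2023, HAL p.550 L32–53;
KlainermanSzeftel2021, l.21571–21586] -/
theorem charge_eq_zero_iff (l : Locus) : charge l = 0 ↔ l = .ksM6Step8Int := by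
  cases l <;> decide

/-- Every other printed instance is charged at least one — the cost `InitializationLedger.frameToRicciCost` that Prop 2.2.3's `div'f ∈ trχ'`
forces. [cite: KlainermanSzeftel2023, Prop 2.2.3 HAL p.63 L41, p.64 L2] -/
theorem one_le_charge_of_ne (l : Locus) (h : l ≠ .ksM6Step8Int) : (frameToRicciCost : ℤ) ≤ charge l := by
  cases l <;> simp_all [charge, minCoeff, ricciIdx, InitializationLedger.frameToRicciCost]

/-- The charge the calculus of §2 assigns to the E31 locus, versus the printed one: 1 vs 0. [folklore] -/
theorem e31_charge_deficit (kl bg : ℕ) (hkl : 1 ≤ kl) (hbg : kl + 2 ≤ bg) :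
    ((mint kl bg).low : ℤ) - (ricciLevel (mint kl bg) : ℤ) = frameToRicciCost ∧ charge .ksM6Step8Int = 0 ∧
    ((mint kl bg).low : ℤ) - (targetM6 kl : ℤ) = charge .ksM6Step8Int := by
  rw [(mint_eq_printed kl bg hbg).1]
  simp only [ricciLevel_def, low_mk, InitializationLedger.intLevel_def, InitializationLedger.intFLevel6_def,
    InitializationLedger.frameToRicciCost_def, InitializationLedger.targetM6_def, charge, minCoeff, ricciIdx]
  omega

/-! ## §4 The whole printed chain from the data norm to `{Ξ', trX̌', X̂'}|_{(int)ℳ}`: eleven against ten (GAPS Block 33 (6)) -/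

/-- The Σ_* descent of §8.4 Steps 4–8, as printed: (8.4.4) `k_large + 6` ↦ (8.4.27) `k_large + 2` (`InitializationLedger.m6_descent_itemised`: 4). [cite: KlainermanSzeftel2023, HAL p.536–548] -/
def sigmaDescent (kl : ℕ) : ℕ := supLevel kl - sigmaStarLevel kl

/-- [Shen]'s hierarchy delivers `L²(S)` control at `K = s_max + 1`: a GAIN of one over the index `s_max` fed to it (`GCMHRungLedger.K`). [cite: Shen2023GCM, K := s_max+1, arXiv v2 l.2518; KlainermanSzeftel2023, (8.4.3) HAL p.536] -/
def shenGain (kl : ℕ) : ℕ := K (smaxKS kl) - smaxKS kl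

/-- Unfolding lemma. [folklore] -/
@[simp] lemma sigmaDescent_def (kl : ℕ) : sigmaDescent kl = supLevel kl - sigmaStarLevel kl := rfl
/-- Unfolding lemma. [folklore] -/
@[simp] lemma shenGain_def (kl : ℕ) : shenGain kl = K (smaxKS kl) - smaxKS kl := rfl

/-- **Total printed loss from `𝓘_{k_large+10}` to the `f`-members of `(int)𝔅`**: Prop 8.2.7 (3) − Shen's gain (1) + Sobolev on S ⊂ Σ_* (2) + the
Σ_* descent (4) + Σ_* → `(ext)` display (0) + Cor 2.2.5 on `(ext)ℳ` (1) + its ingoing analog on `(int)ℳ` (1) + Prop 2.2.3 (1) = 11; the `(ext)ℳ`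
branch spends 10. [cite: KlainermanSzeftel2023, HAL p.486–487, p.535–550] -/
theorem total_loss_eq_eleven (kl : ℕ) :
    prop827Loss - shenGain kl + sobolevCost + sigmaDescent kl + 0 + pgTransportLoss + pgTransportLoss + frameToRicciCost = 11 ∧
    prop827Loss - shenGain kl + sobolevCost + sigmaDescent kl + 0 + pgTransportLoss + frameToRicciCost = 10 ∧
    shenGain kl = 1 ∧ sigmaDescent kl = 4 := by
  simp only [GCMHRungLedger.prop827Loss_def, shenGain_def, GCMHRungLedger.K_def, GCMHRungLedger.smaxKS_def,
    GCMHRungLedger.sobolevCost_def, sigmaDescent_def, InitializationLedger.supLevel_def, GCMHRungLedger.ksTopIndex_def,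
    InitializationLedger.sigmaStarLevel_def, FrameChangeLedger.pgTransportLoss_def, InitializationLedger.frameToRicciCost_def]
  omega

/-- **The printed data index is short by exactly one for the `(int)`/`(top)` branch and exact for the `(ext)` branch**: `(k_large + 10) − 11 =
k_large − 1 < k_large = targetM6`, `(k_large + 10) − 10 = k_large`; and the chain's own bookkeeping agrees with §2's calculus
(`dataIndex − 11 = ricciLevel (mint)`). [cite: KlainermanSzeftel2023, Main Theorem v2 HAL p.143 L2–5 "(ε₀, k_large+10)-admissible", Thm M6 p.159 L9,
p.550 L47–53; KlainermanSzeftel2021, l.6207–6213, l.21583–21587] -/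
theorem data_index_short_by_one (kl bg : ℕ) (hkl : 1 ≤ kl) (hbg : kl + 2 ≤ bg) :
    dataIndex kl - 11 + 1 = targetM6 kl ∧ dataIndex kl - 11 < targetM6 kl ∧ dataIndex kl - 10 = targetM6 kl ∧
    dataIndex kl - 11 = ricciLevel (mint kl bg) := by
  rw [(mint_eq_printed kl bg hbg).1]
  simp only [GCMHRungLedger.dataIndex_def, InitializationLedger.targetM6_def, ricciLevel_def, low_mk,
    InitializationLedger.intLevel_def, InitializationLedger.intFLevel6_def, InitializationLedger.frameToRicciCost_def]
  omega

/-- **Price (c) of Block 33: data one index higher closes the count** — `(k_large + 11) − 11 = k_large` — and it is the hypothesis index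
of the Main Theorem (version 2: "(ε₀, k_large+10)-admissible … 𝓘_{k_large+10} ≤ ε₀²") that moves, by one; equivalently, from
`(ε₀, K)`-admissible data the concluding indices become `(K − 11, ⌊(K − 11)/2⌋ + 1)` in place of the printed `(K − 10, ⌊(K − 10)/2⌋ + 1)`.
[cite: KlainermanSzeftel2023, Main Theorem (version 2), HAL p.143 L2–5 ff.; KlainermanSzeftel2021, l.6207–6221] -/
theorem data_plus_one_closes (kl : ℕ) :
    (dataIndex kl + 1) - 11 = targetM6 kl ∧ dataIndex kl + 1 = kl + 11 ∧
    ∀ Kd : ℕ, 11 ≤ Kd → (Kd - 10) - (Kd - 11) = 1 := by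
  refine ⟨?_, ?_, fun Kd hK => ?_⟩
  · simp only [GCMHRungLedger.dataIndex_def, InitializationLedger.targetM6_def]; omega
  · simp only [GCMHRungLedger.dataIndex_def]
  · omega

/-- **Price (b) of lead block 31 re-typed (Block 33 (6)(b))**: reading (8.4.4) one index higher, at `k_large + 7`, is NOT available from the one
rung of slack of `GCMHRungLedger.ks_slack_one_rung` — a sup bound at order `k` needs `L²(S)` order `k + sobolevCost`, and `k_large + 7 + 2` exceeds
everything Shen's corollary delivers (`K = k_large + 8`); what remains of (b) is an unprinted sharpening of `prop827Loss` or of `sigmaDescent`.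
[cite: KlainermanSzeftel2023, fn 29 / (8.4.3)–(8.4.4) HAL p.536; Shen2023GCM, "K := s_max+1", arXiv v2 l.2518, as transcribed in `GCMHRungLedger`] -/
theorem price_b_retyped (kl : ℕ) :
    ¬ (ksTopIndex kl + 1 + sobolevCost ≤ K (smaxKS kl)) ∧ ksTopIndex kl + sobolevCost = K (smaxKS kl) ∧
    (prop827Loss - 1) - shenGain kl + sobolevCost + sigmaDescent kl + 0 + pgTransportLoss + pgTransportLoss + frameToRicciCost = 10 ∧
    prop827Loss - shenGain kl + sobolevCost + (sigmaDescent kl - 1) + 0 + pgTransportLoss + pgTransportLoss + frameToRicciCost = 10 := by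
  refine ⟨?_, ?_, ?_, ?_⟩
  · simp only [GCMHRungLedger.ksTopIndex_def, GCMHRungLedger.sobolevCost_def, GCMHRungLedger.K_def, GCMHRungLedger.smaxKS_def]
    omega
  · simp only [GCMHRungLedger.ksTopIndex_def, GCMHRungLedger.sobolevCost_def, GCMHRungLedger.K_def, GCMHRungLedger.smaxKS_def]
  · simp only [GCMHRungLedger.prop827Loss_def, shenGain_def, GCMHRungLedger.K_def, GCMHRungLedger.smaxKS_def,
      GCMHRungLedger.sobolevCost_def, sigmaDescent_def, InitializationLedger.supLevel_def, GCMHRungLedger.ksTopIndex_def,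
      InitializationLedger.sigmaStarLevel_def, FrameChangeLedger.pgTransportLoss_def, InitializationLedger.frameToRicciCost_def]
    omega
  · simp only [GCMHRungLedger.prop827Loss_def, shenGain_def, GCMHRungLedger.K_def, GCMHRungLedger.smaxKS_def,
      GCMHRungLedger.sobolevCost_def, sigmaDescent_def, InitializationLedger.supLevel_def, GCMHRungLedger.ksTopIndex_def,
      InitializationLedger.sigmaStarLevel_def, FrameChangeLedger.pgTransportLoss_def, InitializationLedger.frameToRicciCost_def]
    omega

/-! ## §5 Numerical instances (`k_large = 20`) -/

/-- [folklore] -/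
example : mext 20 30 = ⟨22, 21, 22⟩ ∧ mint 20 30 = ⟨20, 21, 21⟩ ∧ ricciLevel (mext 20 30) = 20 ∧ ricciLevel (mint 20 30) = 19 ∧
    targetM6 20 = 20 ∧ dataIndex 20 = 30 := by decide

/-- [folklore] -/
example : ingoingPG 24 ⟨24, 24, 24⟩ = ⟨23, 24, 24⟩ ∧ ricciLevel ⟨23, 24, 24⟩ = 22 ∧ m8SupNormLevel 20 = 22 ∧
    outgoingPG 40 ⟨24, 24, 24⟩ = ⟨24, 23, 24⟩ ∧ ingoingPG 40 ⟨24, 23, 24⟩ = ⟨22, 23, 23⟩ := by decide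

/-- [folklore] -/
example : charge .ksM6Step8Int = 0 ∧ charge .ksM6Step8Ext = 1 ∧ charge .schwM6 = 2 ∧ charge .ksM8Step6 = 1 ∧ charge .jProp443 = 1 := by
  decide

end Literature.Geometry.Lorentzian.KlainermanSzeftel2021.TransitionLossLedger
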